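import Literature.AlgebraicGeometry.ShimuraVarieties.UnitaryBallHolomorphicLift
import Literature.AlgebraicGeometry.ShimuraVarieties.UnitaryBallHolomorphicDescent
import Literature.AlgebraicGeometry.ShimuraVarieties.UnitaryBallPeterssonRecord
import Literature.NumberTheory.Automorphic.ThetaClassSupply
import HarnessLib

/-!
# The class map datum of a compact ball quotient surface

Reproduction (Literature), junction of tree theorems: definitions and kernel-checked consequences;
no new axioms, no records, every declaration kernel-checked.

Let `X` be a compact ball quotient surface with uniformization datum `D : UnitaryBallUniformisationDatum 2 X`
(`X(ℂ) = Γ \ 𝔹²`), a Sylvester frame `𝔣` (so that `Γ` acts on the Poincaré ball `𝔹²` through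
`D.ballRep 𝔣 : Γ →* U(2,1)`, image `D.ballImage 𝔣`), and the standard Hodge model `stdModel hHD`
of `X^an`. Borel's dictionary (§5.14) identifies the holomorphic `1`-forms on `Γ \ 𝔹²` with the
holomorphic vector-valued automorphic forms on `𝔹²` for the cotangent factor `(Jac γ z)ᵀ`, and those
with the holomorphic WEIGHT FORMS on the group `U(2,1)`: left `Γ`-invariant functions of right
`K`-type `weightOf x₀` (`K = Stab(x₀) ≅ U(2) × U(1)`), via `F ↦ (g ↦ (Jac g x₀)ᵀ F(g x₀))`
(`AutomorphyFactor.toGroup`). Composed with Hodge theory on the compact Kähler surface `X^an`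
(Voisin I Cor. 7.6: `F¹H¹(X; ℂ) = H^{1,0} ≅ Ω¹(X^an)`, the tree's `oneFormOfClassSurface`) this is

* `D.classPull hHD 𝔣 : ℂ ⊗_ℚ H¹(X(ℂ); ℚ) →ₗ[ℂ] weightForms (D.ballImage 𝔣) K (weightOf x₀)`,
  `ω ↦ (g ↦ (Jac g x₀)ᵀ · (D.classLift hHD 𝔣 ω)(g x₀))` — the class map in the DATA direction
  "class ↦ function on the group" (`classPull_apply`; `D.classLift` is the holomorphic lift of
  `UnitaryBallHolomorphicLift`);
* `classPull_mem_holWeightForms` — its values are holomorphic weight forms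
  (`BallForms.holWeightForms`);
* `exists_mem_hodge_F_classPull_eq` — **descent**: every holomorphic weight form of level
  `D.ballImage 𝔣` is `classPull ω` for a class `ω ∈ F¹H¹` (Borel §5.14 descent
  `holFormPullback₁_surjective` + Voisin I Cor. 7.6 `ratPieceOneEquivFormsSurface` + the
  model-independence of the Hodge filtration `hI`);
* `D.classMapDatum hHD hI 𝔣 ιinf hΔ hη : WeightForms.ClassMapDatum ιinf hΔ hη (ℂ ⊗_ℚ H¹(X(ℂ); ℚ))` —
  the four fields `H10 := F¹H¹` (of `BettiUniverse.hodge`), `pull := classPull|_{F¹}`,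
  `Hol := holWeightForms`, `descends` (the theorem above) of the class-map datum of
  `ThetaClassSupply`, over ANY archimedean restriction situation `ιinf : U(2,1) →* G_U(𝔸)`,
  `hΔ`, `hη` (parameters; the adelic side is not constructed here). With it the THETA CLASSES of a
  space of adelic forms `Θ` are the set `WeightForms.thetaClasses ιinf (D.classMapDatum …) Θ`.
* `classPull_injOn_hodge_F`, `classMapDatum_pull_injective` — `pull` is INJECTIVE on `F¹H¹`
  (`toGroupFun_injective` + `classLift_ne_zero`), so `thetaClasses` carries no junk from `ker pull`
  (statement and proof contributed by the SANITY lane, unit pub-hodgecm-mc-sanity-1-g3, SAN-5).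

Also the generic seam behind Hecke translation of classes (N33b): for a pull-back cocycle `A`,
LEFT translation of the group function by `γ` is the group function of the PULL-BACK section
`γ^* F : x ↦ A γ x (F (γ x))` (`toGroupFun_mul_left`; for the cotangent cocycle
`(γ^* F)(z) = (Jac γ z)ᵀ F(γ z)`, `factorPullback_cotangentCocycle_apply`), and `γ^*` maps forms for
`Γ` to forms for `γ⁻¹ Γ γ` (`factorPullback_mem_factorForms`).

References: A. Borel, *Automorphic forms on SL₂(ℝ)*, Cambridge Tracts in Math. 130 (1997), §5.13–5.14
[cite: Borel1997, §5.14]; C. Voisin, *Hodge Theory and Complex Algebraic Geometry I*, Cambridge Stud.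
Adv. Math. 76 (2002), §7.1.1 Cor. 7.6 [cite: VoisinHodgeI2002, §7.1.1 Cor. 7.6].
-/

noncomputable section

open Matrix MulAction Function Set
open scoped TensorProduct
open Literature.Geometry.ComplexHyperbolic
open Literature.Geometry.ComplexHyperbolic.BallModel (U21 Ball Jac x₀)
open Literature.Geometry.Kaehler (holFormsInCharts)
open Literature.NumberTheory.Automorphic
open Literature.NumberTheory.Automorphic.AutomorphyFactor
open Literature.AlgebraicGeometry.HodgeTheory
open Literature.AlgebraicGeometry.Motives (bettiCohomology)

namespace Literature.AlgebraicGeometry.ShimuraVarieties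

/-! ### The pull-back of sections by a group element and left translation on the group -/

namespace BallForms

section Translate

variable {G Y R V : Type*} [Group G] [MulAction G Y] [CommRing R] [AddCommGroup V] [Module R V]

variable (A : G → Y → Module.End R V) in
/-- The **pull-back of a section by `γ`** for the factor `A`: `(γ^* F)(x) = A γ x (F (γ • x))`.
[cite: Borel1997, §5.13] -/
def factorPullback (γ : G) (F : Y → V) : Y → V := fun x ↦ A γ x (F (γ • x))

variable {A : G → Y → Module.End R V}

/-- `factorPullback A γ F x = A γ x (F (γ • x))`. [folklore] -/
@[simp] theorem factorPullback_apply (γ : G) (F : Y → V) (x : Y) :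
    factorPullback A γ F x = A γ x (F (γ • x)) := rfl

/-- A section is a form for `Γ` iff it is fixed by the pull-backs `γ^*`, `γ ∈ Γ`. [folklore] -/
theorem mem_factorForms_iff_factorPullback_eq {Γ : Subgroup G} {F : Y → V} :
    F ∈ factorForms Γ A ↔ ∀ γ ∈ Γ, factorPullback A γ F = F :=
  ⟨fun hF γ hγ ↦ funext fun x ↦ (hF γ hγ x).symm, fun h γ hγ x ↦ (congrFun (h γ hγ) x).symm⟩

/-- **Left translation on the group is pull-back on the space**: for a pull-back cocycle,
`u_F (γ g) = u_{γ^* F} (g)` where `u_F = toGroupFun A o F`. [cite: Borel1997, §5.13–5.14] -/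
theorem toGroupFun_mul_left (hA : IsPullbackCocycle A) (o : Y) (F : Y → V) (γ g : G) :
    toGroupFun A o F (γ * g) = toGroupFun A o (factorPullback A γ F) g := by
  rw [toGroupFun_apply, toGroupFun_apply, factorPullback_apply, hA.map_mul, Module.End.mul_apply,
    mul_smul]

/-- The same as an identity of functions: `(g ↦ u_F (γ g)) = u_{γ^* F}`. [folklore] -/
theorem toGroupFun_comp_mul_left (hA : IsPullbackCocycle A) (o : Y) (F : Y → V) (γ : G) :
    (fun g ↦ toGroupFun A o F (γ * g)) = toGroupFun A o (factorPullback A γ F) :=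
  funext fun g ↦ toGroupFun_mul_left hA o F γ g

/-- `γ^*` is a cocycle action: `(γ δ)^* = δ^* ∘ γ^*`. [folklore] -/
theorem factorPullback_mul (hA : IsPullbackCocycle A) (γ δ : G) (F : Y → V) :
    factorPullback A (γ * δ) F = factorPullback A δ (factorPullback A γ F) := by
  funext x
  rw [factorPullback_apply, factorPullback_apply, factorPullback_apply, hA.map_mul,
    Module.End.mul_apply, mul_smul]

/-- `1^* = id`. [folklore] -/
theorem factorPullback_one (hA : IsPullbackCocycle A) (F : Y → V) : factorPullback A 1 F = F := by
  funext x
  rw [factorPullback_apply, hA.map_one, one_smul, Module.End.one_apply]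

/-- **`γ^*` carries forms for `Γ` to forms for `γ⁻¹ Γ γ`**: if `F ∈ factorForms Γ A` and
`γ δ γ⁻¹ ∈ Γ` for all `δ ∈ Γ'`, then `γ^* F ∈ factorForms Γ' A`. [cite: Borel1997, §5.13] -/
theorem factorPullback_mem_factorForms (hA : IsPullbackCocycle A) {Γ Γ' : Subgroup G} {F : Y → V}
    (hF : F ∈ factorForms Γ A) {γ : G} (hγ : ∀ δ ∈ Γ', γ * δ * γ⁻¹ ∈ Γ) :
    factorPullback A γ F ∈ factorForms Γ' A := by
  rw [mem_factorForms_iff_factorPullback_eq] at hF ⊢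
  intro δ hδ
  rw [← factorPullback_mul hA, show γ * δ = γ * δ * γ⁻¹ * γ by group, factorPullback_mul hA,
    hF _ (hγ δ hδ)]

/-- **For a transitive action the group function determines the section** (on ALL sections, not only
on forms: `F (g • o) = (A g o)⁻¹ (u_F g)`). [cite: Borel1997, §5.13] -/
theorem toGroupFun_injective (hA : IsPullbackCocycle A) (o : Y) [IsPretransitive G Y] :
    Function.Injective (toGroupFun A o : (Y → V) → G → V) := by
  intro F F' h
  funext x
  obtain ⟨g, rfl⟩ := exists_smul_eq G o x
  have hg := congrFun h g
  rw [toGroupFun_apply, toGroupFun_apply] at hg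
  have hg' := congrArg (A g⁻¹ (g • o)) hg
  rwa [hA.inv_apply_apply, hA.inv_apply_apply] at hg'

/-- **Hecke-translate dictionary, section form**: if the group function of `F'` is the LEFT translate
by `γ` of the group function of `F`, then `F' = γ^* F`. [cite: Borel1997, §5.13–5.14] -/
theorem eq_factorPullback_of_toGroupFun_eq (hA : IsPullbackCocycle A) (o : Y) [IsPretransitive G Y]
    {F F' : Y → V} {γ : G} (h : toGroupFun A o F' = fun g ↦ toGroupFun A o F (γ * g)) :
    F' = factorPullback A γ F :=
  toGroupFun_injective hA o (h.trans (toGroupFun_comp_mul_left hA o F γ))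

end Translate

/-- `U(2,1)` acts transitively on `𝔹²` (the tree's `BallModel.transitive`, as the Mathlib class).
[cite: Jacobowitz1990, Ch. 2 §1, Lemma 6(1) (p. 41)] -/
theorem isPretransitive_U21_ball : IsPretransitive U21 Ball :=
  ⟨fun x y ↦ BallModel.transitive x y⟩

/-- For the cotangent cocycle: `(γ^* F)(z) = (Jac γ z)ᵀ F(γ z)` (the pull-back of the `(1,0)`-form
`Σ Fᵢ dzᵢ`). [cite: Borel1997, §5.14] -/
theorem factorPullback_cotangentCocycle_apply (γ : U21) (F : Ball → (Fin 2 → ℂ)) (z : Ball) :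
    factorPullback cotangentCocycle γ F z = (Jac γ z)ᵀ *ᵥ F (γ • z) := by
  rw [factorPullback_apply, cotangentCocycle_apply]

end BallForms

/-! ### The class pull map of a compact ball quotient surface -/

namespace UnitaryBallUniformisationDatum

variable {X : Motives.SchemeOver ℂ} (D : UnitaryBallUniformisationDatum 2 X)
variable (hHD : exists_isReal_hodgeModel) (𝔣 : D.SylvesterFrame)

/-- **The class pull map** `ℂ ⊗_ℚ H¹(X(ℂ); ℚ) → weightForms (D.ballImage 𝔣) K (weightOf x₀)`:
the holomorphic `1`-form of (the `(1,0)`-part of) a class, pulled back to the ball (`holFormPullback₁`,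
Borel §5.14) and read on the group through `toGroup` at the base point `x₀`
(`ω ↦ (g ↦ (Jac g x₀)ᵀ (classLift ω)(g x₀))`). [cite: Borel1997, §5.14]
[cite: VoisinHodgeI2002, §7.1.1 Cor. 7.6] -/
def classPull : (ℂ ⊗[ℚ] bettiCohomology X 1) →ₗ[ℂ]
    weightForms (D.ballImage 𝔣) (stabilizer U21 x₀).subtype
      (BallForms.isPullbackCocycle_cotangentCocycle.weightOf x₀) :=
  toGroup BallForms.isPullbackCocycle_cotangentCocycle x₀ ∘ₗ
    Submodule.inclusion (inf_le_left :
        BallForms.holFactorForms (D.ballImage 𝔣) BallForms.cotangentCocycle ≤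
          factorForms (D.ballImage 𝔣) BallForms.cotangentCocycle) ∘ₗ
      D.holFormPullback₁ (stdModel hHD D.isSmoothProjective) 𝔣 ⊤ ∘ₗ
        (stdModel hHD D.isSmoothProjective).oneFormOfClassSurface D.isSmoothProjective

/-- The group function of `classPull ω` is `toGroupFun` of the holomorphic lift `classLift ω`.
[folklore] -/
theorem coe_classPull (c : ℂ ⊗[ℚ] bettiCohomology X 1) :
    (D.classPull hHD 𝔣 c : U21 → (Fin 2 → ℂ)) =
      toGroupFun BallForms.cotangentCocycle x₀ (D.classLift hHD 𝔣 c) :=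
  rfl

/-- `classPull ω g = (Jac g x₀)ᵀ (classLift ω)(g x₀)`. [cite: Borel1997, §5.14] -/
theorem classPull_apply (c : ℂ ⊗[ℚ] bettiCohomology X 1) (g : U21) :
    (D.classPull hHD 𝔣 c : U21 → (Fin 2 → ℂ)) g = (Jac g x₀)ᵀ *ᵥ D.classLift hHD 𝔣 c (g • x₀) := by
  rw [coe_classPull, toGroupFun_apply, BallForms.cotangentCocycle_apply]

/-- **Left translates of `classPull ω` are the group functions of the pulled-back lifts**
`γ^*(classLift ω) : z ↦ (Jac γ z)ᵀ (classLift ω)(γ z)` (the seam behind the Hecke translation of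
theta classes, N33b). [cite: Borel1997, §5.13–5.14] -/
theorem classPull_apply_mul_left (c : ℂ ⊗[ℚ] bettiCohomology X 1) (γ g : U21) :
    (D.classPull hHD 𝔣 c : U21 → (Fin 2 → ℂ)) (γ * g) =
      toGroupFun BallForms.cotangentCocycle x₀
        (fun z ↦ (Jac γ z)ᵀ *ᵥ D.classLift hHD 𝔣 c (γ • z)) g := by
  rw [coe_classPull, BallForms.toGroupFun_mul_left BallForms.isPullbackCocycle_cotangentCocycle]
  exact congrArg (toGroupFun BallForms.cotangentCocycle x₀ · g)
    (funext fun z ↦ BallForms.factorPullback_cotangentCocycle_apply γ _ z)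

/-- **Hecke-translate dictionary for lifts**: a section `F'` on the ball whose group function is the
left translate `g ↦ (classPull ω)(γ g)` IS the pulled-back lift `z ↦ (Jac γ z)ᵀ (classLift ω)(γ z)`
(transitivity of `U(2,1)` on `𝔹²`; the shape of the translation clause of the geometric ball data).
[cite: Borel1997, §5.13–5.14] -/
theorem eq_of_toGroupFun_eq_classPull_mul_left (c : ℂ ⊗[ℚ] bettiCohomology X 1) (γ : U21)
    {F' : Ball → (Fin 2 → ℂ)}
    (h : toGroupFun BallForms.cotangentCocycle x₀ F' =
      fun g ↦ (D.classPull hHD 𝔣 c : U21 → (Fin 2 → ℂ)) (γ * g)) :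
    F' = fun z ↦ (Jac γ z)ᵀ *ᵥ D.classLift hHD 𝔣 c (γ • z) := by
  haveI := BallForms.isPretransitive_U21_ball
  have h' := BallForms.eq_factorPullback_of_toGroupFun_eq
    BallForms.isPullbackCocycle_cotangentCocycle x₀ (F := D.classLift hHD 𝔣 c) (γ := γ) h
  rw [h']
  funext z
  exact BallForms.factorPullback_cotangentCocycle_apply γ _ z

/-- The values of `classPull` are holomorphic weight forms. [cite: Borel1997, §5.14] -/
theorem classPull_mem_holWeightForms (c : ℂ ⊗[ℚ] bettiCohomology X 1) :
    D.classPull hHD 𝔣 c ∈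
      BallForms.holWeightForms (D.ballImage 𝔣) BallForms.isPullbackCocycle_cotangentCocycle :=
  ⟨Submodule.inclusion inf_le_left (D.holFormPullback₁ (stdModel hHD D.isSmoothProjective) 𝔣 ⊤
      ((stdModel hHD D.isSmoothProjective).oneFormOfClassSurface D.isSmoothProjective c)),
    (D.holFormPullback₁ (stdModel hHD D.isSmoothProjective) 𝔣 ⊤ _).2, rfl⟩

/-- `F¹` of the universe's Hodge structure contains `Θ⁻¹(H^{1,0})` of the standard model (the
converse of `mem_ratPiece_stdModel_of_mem_hodge_F`; model-independence `hI`).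
[cite: VoisinHodgeI2002, §6.1.3 Prop. 6.11 and §7.1.1 Def. 7.4] -/
theorem mem_hodge_F_of_mem_ratPiece_stdModel (hI : hodgePQ_independent_of_hodgeModel) {n : ℕ}
    (hX : Motives.IsSmoothProjective n X) {k : ℕ} {c : ℂ ⊗[ℚ] bettiCohomology X k}
    (hc : c ∈ (stdModel hHD hX).ratPiece hX k k 0) : c ∈ (BettiUniverse.hodge hHD hX k).F k := by
  have h1 : c ∈ (BettiUniverse.realHodgeModel hHD hX).ratPiece hX k k 0 := by
    rw [HodgeModel.mem_ratPiece_iff, HodgeModel.complexification_apply] at hc ⊢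
    exact (hI.mem_hodgePQ_iff hX _ _).1 hc
  rw [BettiUniverse.hodge_F]
  exact ((BettiUniverse.realHodgeModel hHD hX).ratF_self_eq_ratPiece hX k).symm.le h1

/-- **Descent**: every holomorphic weight form of level `D.ballImage 𝔣` is `classPull ω` for a class
`ω ∈ F¹H¹(X)` — holomorphic forms on the ball for `Γ` descend to holomorphic `1`-forms on the compact
quotient (Borel §5.14), which are the `(1,0)`-parts of classes (Voisin I Cor. 7.6).
[cite: Borel1997, §5.14] [cite: VoisinHodgeI2002, §7.1.1 Cor. 7.6] -/
theorem exists_mem_hodge_F_classPull_eq (hI : hodgePQ_independent_of_hodgeModel)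
    {f : weightForms (D.ballImage 𝔣) (stabilizer U21 x₀).subtype
      (BallForms.isPullbackCocycle_cotangentCocycle.weightOf x₀)}
    (hf : f ∈ BallForms.holWeightForms (D.ballImage 𝔣) BallForms.isPullbackCocycle_cotangentCocycle) :
    ∃ c ∈ (BettiUniverse.hodge hHD D.isSmoothProjective 1).F 1, D.classPull hHD 𝔣 c = f := by
  obtain ⟨F, hF, rfl⟩ := hf
  obtain ⟨α, hα⟩ := D.holFormPullback₁_surjective (stdModel hHD D.isSmoothProjective) 𝔣 ⟨F, hF⟩
  refine ⟨((stdModel hHD D.isSmoothProjective).ratPieceOneEquivFormsSurface D.isSmoothProjective).symm α,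
    mem_hodge_F_of_mem_ratPiece_stdModel hHD hI D.isSmoothProjective (Submodule.coe_mem _), ?_⟩
  have hx : (stdModel hHD D.isSmoothProjective).oneFormOfClassSurface D.isSmoothProjective
      ((((stdModel hHD D.isSmoothProjective).ratPieceOneEquivFormsSurface D.isSmoothProjective).symm α :
          ↥((stdModel hHD D.isSmoothProjective).ratPiece D.isSmoothProjective 1 1 0)) :
        ℂ ⊗[ℚ] bettiCohomology X 1) = α := by
    rw [← HodgeModel.ratPieceOneEquivFormsSurface_apply, LinearEquiv.apply_symm_apply]
  simp only [classPull, LinearMap.coe_comp, Function.comp_apply]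
  refine congrArg (toGroup BallForms.isPullbackCocycle_cotangentCocycle x₀) (Subtype.ext ?_)
  rw [Submodule.coe_inclusion, hx]
  exact congrArg Subtype.val hα

/-! ### The class map datum -/

section ClassMapDatum

variable {GU : Type*} [Group GU] {Kc : Type*} [Group Kc]
variable {ΓU : Subgroup GU} {κ : Kc →* GU} {τ : Representation ℂ Kc (Fin 2 → ℂ)}

/-- **The class map datum of the ball quotient surface** over an archimedean restriction situation
`ιinf : U(2,1) →* G_U` (level-corrected `hΔ` for `Δ = D.ballImage 𝔣`, weight-matched `hη` for
`K₁ = Stab(x₀)`, `τ₁ = weightOf x₀` of the cotangent cocycle): `H10 := F¹(ℂ ⊗_ℚ H¹(X(ℂ); ℚ))`,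
`pull := classPull|_{F¹}`, `Hol :=` the holomorphic weight forms, and DESCENT proved
(`exists_mem_hodge_F_classPull_eq`). [cite: Borel1997, §5.14] [cite: VoisinHodgeI2002, §7.1.1 Cor. 7.6] -/
def classMapDatum (hI : hodgePQ_independent_of_hodgeModel) (ιinf : U21 →* GU)
    {η₁ : stabilizer U21 x₀ →* Kc} (hΔ : WeightForms.IsLevelCorrected ΓU κ τ ιinf (D.ballImage 𝔣))
    (hη : WeightForms.IsWeightMatched κ τ ιinf (stabilizer U21 x₀).subtype
      (BallForms.isPullbackCocycle_cotangentCocycle.weightOf x₀) η₁) :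
    WeightForms.ClassMapDatum ιinf hΔ hη (ℂ ⊗[ℚ] bettiCohomology X 1) where
  H10 := (BettiUniverse.hodge hHD D.isSmoothProjective 1).F 1
  pull := D.classPull hHD 𝔣 ∘ₗ ((BettiUniverse.hodge hHD D.isSmoothProjective 1).F 1).subtype
  Hol := BallForms.holWeightForms (D.ballImage 𝔣) BallForms.isPullbackCocycle_cotangentCocycle
  descends f hf := by
    obtain ⟨c, hc, h⟩ := D.exists_mem_hodge_F_classPull_eq hHD 𝔣 hI hf
    exact ⟨⟨c, hc⟩, h⟩

variable (hI : hodgePQ_independent_of_hodgeModel) (ιinf : U21 →* GU)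
  {η₁ : stabilizer U21 x₀ →* Kc} (hΔ : WeightForms.IsLevelCorrected ΓU κ τ ιinf (D.ballImage 𝔣))
  (hη : WeightForms.IsWeightMatched κ τ ιinf (stabilizer U21 x₀).subtype
    (BallForms.isPullbackCocycle_cotangentCocycle.weightOf x₀) η₁)

/-- `H10 = F¹H¹`. [folklore] -/
@[simp] theorem classMapDatum_H10 :
    (D.classMapDatum hHD 𝔣 hI ιinf hΔ hη).H10 = (BettiUniverse.hodge hHD D.isSmoothProjective 1).F 1 :=
  rfl

/-- `Hol =` the holomorphic weight forms. [folklore] -/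
@[simp] theorem classMapDatum_Hol :
    (D.classMapDatum hHD 𝔣 hI ιinf hΔ hη).Hol =
      BallForms.holWeightForms (D.ballImage 𝔣) BallForms.isPullbackCocycle_cotangentCocycle :=
  rfl

/-- `pull c = classPull c`. [folklore] -/
@[simp] theorem classMapDatum_pull (c : (D.classMapDatum hHD 𝔣 hI ιinf hΔ hη).H10) :
    (D.classMapDatum hHD 𝔣 hI ιinf hΔ hη).pull c =
      D.classPull hHD 𝔣 (c : ℂ ⊗[ℚ] bettiCohomology X 1) :=
  rfl

/-- `pull c g = (Jac g x₀)ᵀ (classLift c)(g x₀)` — the class map datum and the holomorphic lift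
`classLift` (the evaluation `ev` of the geometric ball data) are one object. [cite: Borel1997, §5.14] -/
theorem classMapDatum_pull_apply (c : (D.classMapDatum hHD 𝔣 hI ιinf hΔ hη).H10) (g : U21) :
    ((D.classMapDatum hHD 𝔣 hI ιinf hΔ hη).pull c : U21 → (Fin 2 → ℂ)) g =
      (Jac g x₀)ᵀ *ᵥ D.classLift hHD 𝔣 (c : ℂ ⊗[ℚ] bettiCohomology X 1) (g • x₀) :=
  D.classPull_apply hHD 𝔣 _ g

/-- **Theta classes are `(1,0)`-classes**: for any space `Θ` of adelic weight forms,
`thetaClasses ιinf (D.classMapDatum …) Θ ⊆ F¹H¹(X)`. [folklore] -/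
theorem thetaClasses_subset_hodge_F (Θ : Submodule ℂ (weightForms ΓU κ τ)) :
    WeightForms.thetaClasses ιinf (D.classMapDatum hHD 𝔣 hI ιinf hΔ hη) Θ ⊆
      (BettiUniverse.hodge hHD D.isSmoothProjective 1).F 1 :=
  WeightForms.thetaClasses_subset ιinf _ Θ

/-- **A theta class, unfolded on the ball**: `ω` is a theta class of `Θ` iff `ω ∈ F¹H¹` and for some
`F ∈ Θ`, holomorphic after restriction, `(Jac g x₀)ᵀ (classLift ω)(g x₀) = F(ιinf g · c_g)` for all
`g ∈ U(2,1)` (`restrictHom`). [folklore] -/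
theorem mem_thetaClasses_iff (Θ : Submodule ℂ (weightForms ΓU κ τ)) (h : ℂ ⊗[ℚ] bettiCohomology X 1) :
    h ∈ WeightForms.thetaClasses ιinf (D.classMapDatum hHD 𝔣 hI ιinf hΔ hη) Θ ↔
      h ∈ (BettiUniverse.hodge hHD D.isSmoothProjective 1).F 1 ∧
        ∃ F ∈ Θ, WeightForms.restrictHom ιinf hΔ hη F ∈
            BallForms.holWeightForms (D.ballImage 𝔣) BallForms.isPullbackCocycle_cotangentCocycle ∧
          D.classPull hHD 𝔣 h = WeightForms.restrictHom ιinf hΔ hη F := by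
  constructor
  · rintro ⟨c, rfl, F, hF, hHol, hc⟩
    exact ⟨c.2, F, hF, hHol, hc⟩
  · rintro ⟨hh, F, hF, hHol, hc⟩
    exact ⟨⟨h, hh⟩, rfl, F, hF, hHol, hc⟩

include hI in
/-- **`classPull` is injective on `F¹H¹`**: a class in `F¹H¹` with vanishing group function has
vanishing holomorphic lift (`toGroupFun_injective`, transitivity of `U(2,1)` on `𝔹²`), hence is zero
(`classLift_ne_zero`). [cite: Borel1997, §5.13–5.14] [cite: VoisinHodgeI2002, §7.1.1 Cor. 7.6] -/
theorem classPull_injOn_hodge_F :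
    Set.InjOn (D.classPull hHD 𝔣) ((BettiUniverse.hodge hHD D.isSmoothProjective 1).F 1 : Set _) := by
  haveI : IsPretransitive U21 Ball := BallForms.isPretransitive_U21_ball
  intro c hc c' hc' h
  rw [← sub_eq_zero]
  by_contra hne
  refine D.classLift_ne_zero hHD 𝔣 hI (Submodule.sub_mem _ hc hc') hne ?_
  apply BallForms.toGroupFun_injective BallForms.isPullbackCocycle_cotangentCocycle x₀
  have h0 : (D.classPull hHD 𝔣 (c - c') : U21 → Fin 2 → ℂ) = 0 := by
    rw [map_sub, h, sub_self]
    rfl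
  rw [← coe_classPull, h0]
  funext g
  simp [toGroupFun_apply]

/-- **The pullback of the class map datum is injective** (so `thetaClasses` through it has no junk
from `ker pull`). [cite: Borel1997, §5.13–5.14] [cite: VoisinHodgeI2002, §7.1.1 Cor. 7.6] -/
theorem classMapDatum_pull_injective :
    Function.Injective (D.classMapDatum hHD 𝔣 hI ιinf hΔ hη).pull := fun c c' h ↦
  Subtype.ext (D.classPull_injOn_hodge_F hHD 𝔣 hI c.2 c'.2 h)


end ClassMapDatum

end UnitaryBallUniformisationDatum

end Literature.AlgebraicGeometry.ShimuraVarieties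

end
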